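import Summits.SmoothPoincare4.SmoothPoincare4.Theorems.EntropyRungSubcylindricalExistenceSmoothedConeModelMetric
import Literature.Geometry.Riemannian.GradientEstimateIntegration
import HarnessLib

/-!
# Distance comparison for the smoothed cone `e^{2θ(‖x‖²)} δ` on `ℝ⁴`
(aux file 3 of stub `helper_smoothedConeModel`, line `fat-conical-core-avr-logsobolev`, crux
`EntropyRung.SubcylindricalExistence`, item stmt-SmoothPoincare4-10871)

Let `g_c` be a Riemannian metric on `ℝ⁴ = EuclideanSpace ℝ (Fin 4)` with
`g_c(x)(v, w) = e^{2θ(‖x‖²)} ⟪v, w⟫`, where the smooth profile `θ` is the exact cone of slope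
`c ∈ (0, 1]` outside the unit ball, `θ(s) = log c + ((c−1)/2) log s` for `s ≥ 1`, and let `Ψ` be a
smooth radial comparison profile with `Ψ(s) = s^{c/2}` for `s ≥ 1` and `2|Ψ'(s)|√s ≤ e^{θ(s)}`
(file `…SmoothedConeModelProfile`). Then the Riemannian distance `d = g_c.edist` from the origin is
the cone distance `‖y‖^c` up to a bounded error (`helper_smoothedConeModel_distance`):
`‖y‖^c − C ≤ d(0, y) ≤ ‖y‖^c + C`.

* Upper bound: the segment `[0, y]` has bounded `g_c`-length for `‖y‖ ≤ 1` (continuity), and for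
  `‖y‖ ≥ 1` the radial path `u ↦ u^{1/c} ŷ`, `u ∈ [1, ‖y‖^c]`, has unit `g_c`-speed in the cone
  region, so `d(ŷ, y) ≤ ‖y‖^c − 1` (`edist_le_length`, `length_eq_lintegral`).
* Lower bound: `y ↦ Ψ(‖y‖²)` has `|d(Ψ∘‖·‖²)(v)| ≤ |v|_{g_c}`, hence is `1`-Lipschitz for `d`
  (`ofReal_abs_sub_le_mul_riemEDist`), and equals `‖y‖^c` outside the unit ball.

Everything is proved; no definition, no named fact. References: O'Neill 1983, Ch. 5, Def. 15 and
Prop. 18 [ONeill1983]; Petersen 2016, §4.2.3 [Petersen2016].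
-/

noncomputable section

-- the registered namespace `Summit.SmoothPoincare4.SmoothPoincare4.Theorems` repeats a component
set_option linter.dupNamespace false

open scoped Manifold ContDiff Topology RealInnerProductSpace ENNReal NNReal
open Set Filter Function MeasureTheory
open Literature.Geometry.Lorentzian Literature.Geometry.Riemannian

namespace Summit.SmoothPoincare4.SmoothPoincare4.Theorems

namespace SmoothedConeModelDistance

variable {θ : ℝ → ℝ}
  {gc : PseudoRiemannianMetric 𝓘(ℝ, EuclideanFour) ∞ EuclideanFour
    (TangentSpace 𝓘(ℝ, EuclideanFour) : EuclideanFour → Type _)}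
  (hgc : gc.IsRiemannian)
  (hval : ∀ (x : EuclideanFour) (v w : EuclideanFour),
    gc.val x v w = Real.exp (2 * θ (‖x‖ ^ 2)) * ⟪v, w⟫)

/-! ## The `g_c`-speed `|v|_{g_c} = e^{θ(‖x‖²)} ‖v‖` -/

include hval in
/-- `g_c(x)(v,v)^{1/2} = e^{θ(‖x‖²)} ‖v‖`. [folklore] -/
theorem sqrt_val (x v : EuclideanFour) :
    Real.sqrt (gc.val x v v) = Real.exp (θ (‖x‖ ^ 2)) * ‖v‖ := by
  rw [hval, real_inner_self_eq_norm_sq,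
    show Real.exp (2 * θ (‖x‖ ^ 2)) * ‖v‖ ^ 2 = (Real.exp (θ (‖x‖ ^ 2)) * ‖v‖) ^ 2 by
      rw [mul_pow, sq (Real.exp _), ← Real.exp_add, two_mul],
    Real.sqrt_sq (by positivity)]

/-! ## The length of a path `t ↦ r(t) • e` -/

include hval in
/-- The `g_c`-length of a `C¹` path in `ℝ⁴` is the integral of `e^{θ(‖γ‖²)} ‖γ'‖`. [folklore] -/
theorem length_eq (γ : ℝ → EuclideanFour) {γ' : ℝ → EuclideanFour}
    (hγ : ∀ t, HasDerivAt γ (γ' t) t) (a b : ℝ) :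
    gc.length hgc γ a b =
      ∫⁻ t in Icc a b, ENNReal.ofReal (Real.exp (θ (‖γ t‖ ^ 2)) * ‖γ' t‖) := by
  rw [PseudoRiemannianMetric.length_eq_lintegral]
  refine lintegral_congr fun t ↦ ?_
  have hd : mfderiv 𝓘(ℝ, ℝ) 𝓘(ℝ, EuclideanFour) γ t 1 = γ' t := by
    have h1 : fderiv ℝ γ t 1 = γ' t := by
      rw [fderiv_apply_one_eq_deriv, (hγ t).deriv]
    rw [mfderiv_eq_fderiv]
    exact h1
  rw [hd, sqrt_val hval]

/-! ## Upper bound near the origin -/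

include hval in
/-- **Bounded distance on the unit ball**: `d(0, y) ≤ C₀` for `‖y‖ ≤ 1`, with
`C₀ = max_{[0,1]} e^{θ}` (length of the segment `[0, y]`). [folklore] -/
theorem exists_edist_zero_le_of_norm_le_one (hθ : Continuous θ) :
    ∃ C₀ : ℝ, 0 ≤ C₀ ∧ ∀ y : EuclideanFour, ‖y‖ ≤ 1 → gc.edist hgc 0 y ≤ ENNReal.ofReal C₀ := by
  obtain ⟨C₀, hC₀⟩ := isCompact_Icc.exists_bound_of_continuousOn
    (f := fun u ↦ Real.exp (θ u)) (s := Icc (0 : ℝ) 1) (Real.continuous_exp.comp hθ).continuousOn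
  have hC₀0 : 0 ≤ C₀ := le_trans (norm_nonneg _) (hC₀ 0 ⟨le_rfl, zero_le_one⟩)
  refine ⟨C₀, hC₀0, fun y hy ↦ ?_⟩
  -- the segment `γ t = t • y`
  have hγd : ∀ t, HasDerivAt (fun t : ℝ ↦ t • y) y t := fun t ↦ by
    simpa using (hasDerivAt_id t).smul_const y
  have hγs : ContMDiffOn 𝓘(ℝ, ℝ) 𝓘(ℝ, EuclideanFour) 1 (fun t : ℝ ↦ t • y) (Icc 0 1) :=
    (contMDiff_iff_contDiff.2 (contDiff_id.smul contDiff_const)).contMDiffOn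
  have h := PseudoRiemannianMetric.edist_le_length hgc zero_le_one hγs
  simp only [zero_smul, one_smul] at h
  refine h.trans ?_
  rw [length_eq hgc hval _ hγd]
  calc ∫⁻ t in Icc (0 : ℝ) 1, ENNReal.ofReal (Real.exp (θ (‖t • y‖ ^ 2)) * ‖y‖)
      ≤ ∫⁻ _ in Icc (0 : ℝ) 1, ENNReal.ofReal C₀ := by
        refine setLIntegral_mono' measurableSet_Icc fun t ht ↦ ENNReal.ofReal_le_ofReal ?_
        have ht2 : ‖t • y‖ ^ 2 ∈ Icc (0 : ℝ) 1 := by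
          refine ⟨sq_nonneg _, ?_⟩
          rw [norm_smul, Real.norm_eq_abs, abs_of_nonneg ht.1]
          have : t * ‖y‖ ≤ 1 := by nlinarith [ht.1, ht.2, norm_nonneg y]
          nlinarith [mul_nonneg ht.1 (norm_nonneg y)]
        have h1 : Real.exp (θ (‖t • y‖ ^ 2)) ≤ C₀ := le_trans (Real.le_norm_self _) (hC₀ _ ht2)
        calc Real.exp (θ (‖t • y‖ ^ 2)) * ‖y‖ ≤ C₀ * 1 :=
            mul_le_mul h1 hy (norm_nonneg _) hC₀0
          _ = C₀ := mul_one _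
    _ = ENNReal.ofReal C₀ := by
        rw [setLIntegral_const, Real.volume_Icc, sub_zero, ENNReal.ofReal_one, mul_one]

/-! ## Upper bound in the cone region -/

include hval in
/-- **The radial unit-speed path in the cone region**: for `‖y‖ ≥ 1` and
`θ = log c + ((c−1)/2) log` on `[1, ∞)`, `d(ŷ, y) ≤ ‖y‖^c − 1` (`ŷ = y/‖y‖`; the path
`u ↦ u^{1/c} ŷ`, `u ∈ [1, ‖y‖^c]`, has `g_c`-speed `c (u^{1/c})^{c−1} · c⁻¹ u^{1/c − 1} = 1`). [folklore] -/
theorem edist_unit_le {c : ℝ} (hc : 0 < c)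
    (hcone : ∀ s : ℝ, 1 ≤ s → θ s = Real.log c + (c - 1) / 2 * Real.log s)
    {y : EuclideanFour} (hy : 1 ≤ ‖y‖) :
    gc.edist hgc (‖y‖⁻¹ • y) y ≤ ENNReal.ofReal (‖y‖ ^ c - 1) := by
  set ρ : ℝ := ‖y‖ with hρ
  have hρ0 : 0 < ρ := lt_of_lt_of_le one_pos hy
  set e : EuclideanFour := ρ⁻¹ • y with he
  have he1 : ‖e‖ = 1 := by
    rw [he, norm_smul, norm_inv, Real.norm_eq_abs, abs_of_pos hρ0, ← hρ, inv_mul_cancel₀ hρ0.ne']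
  have hρc : 1 ≤ ρ ^ c := Real.one_le_rpow hy hc.le
  -- the path and its derivative
  set γ : ℝ → EuclideanFour := fun u ↦ (u ^ c⁻¹) • e with hγ
  have hγd : ∀ u, 0 < u → HasDerivAt γ ((c⁻¹ * u ^ (c⁻¹ - 1)) • e) u := fun u hu ↦
    (Real.hasDerivAt_rpow_const (Or.inl hu.ne')).smul_const e
  have hγs : ContMDiffOn 𝓘(ℝ, ℝ) 𝓘(ℝ, EuclideanFour) 1 γ (Icc 1 (ρ ^ c)) := by
    refine contMDiffOn_iff_contDiffOn.2 fun u hu ↦ ?_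
    have hu0 : u ≠ 0 := (lt_of_lt_of_le one_pos hu.1).ne'
    exact ((Real.contDiffAt_rpow_const_of_ne (p := c⁻¹) hu0).smul contDiffAt_const).contDiffWithinAt
  have h := PseudoRiemannianMetric.edist_le_length hgc hρc hγs
  have hγ1 : γ 1 = e := by rw [hγ]; simp
  have hγ2 : γ (ρ ^ c) = y := by
    rw [hγ]
    dsimp only
    rw [Real.rpow_rpow_inv hρ0.le hc.ne', he, smul_smul, mul_inv_cancel₀ hρ0.ne', one_smul]
  rw [hγ1, hγ2] at h
  refine h.trans (le_of_eq ?_)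
  -- the length: unit speed on `[1, ρ^c]`
  rw [PseudoRiemannianMetric.length_eq_lintegral]
  have hspeed : ∀ u ∈ Icc 1 (ρ ^ c), ENNReal.ofReal (Real.sqrt (gc.val (γ u)
      (mfderiv 𝓘(ℝ, ℝ) 𝓘(ℝ, EuclideanFour) γ u 1) (mfderiv 𝓘(ℝ, ℝ) 𝓘(ℝ, EuclideanFour) γ u 1))) = 1 := by
    intro u hu
    have hu0 : 0 < u := lt_of_lt_of_le one_pos hu.1
    have hd : mfderiv 𝓘(ℝ, ℝ) 𝓘(ℝ, EuclideanFour) γ u 1 = (c⁻¹ * u ^ (c⁻¹ - 1)) • e := by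
      have h1 : fderiv ℝ γ u 1 = (c⁻¹ * u ^ (c⁻¹ - 1)) • e := by
        rw [fderiv_apply_one_eq_deriv, (hγd u hu0).deriv]
      rw [mfderiv_eq_fderiv]
      exact h1
    rw [hd, sqrt_val hval, ← ENNReal.ofReal_one]
    congr 1
    have hnorm : ‖γ u‖ = u ^ c⁻¹ := by
      rw [hγ]
      dsimp only
      rw [norm_smul, he1, mul_one, Real.norm_eq_abs, abs_of_nonneg (Real.rpow_nonneg hu0.le _)]
    have hpow : 1 ≤ ‖γ u‖ ^ 2 := by
      rw [hnorm]
      have : 1 ≤ u ^ c⁻¹ := Real.one_le_rpow hu.1 (inv_nonneg.2 hc.le)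
      nlinarith
    rw [hcone _ hpow, hnorm, norm_smul, he1, mul_one, Real.norm_eq_abs,
      abs_of_pos (mul_pos (inv_pos.2 hc) (Real.rpow_pos_of_pos hu0 _)),
      Real.rpow_def_of_pos hu0, Real.rpow_def_of_pos hu0, ← Real.exp_nat_mul, Real.log_exp,
      Real.exp_add, Real.exp_log hc]
    push_cast
    have hcc : c * c⁻¹ = 1 := mul_inv_cancel₀ hc.ne'
    calc c * Real.exp ((c - 1) / 2 * (2 * (Real.log u * c⁻¹))) * (c⁻¹ * Real.exp (Real.log u * (c⁻¹ - 1)))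
        = (c * c⁻¹) * Real.exp ((c - 1) / 2 * (2 * (Real.log u * c⁻¹)) + Real.log u * (c⁻¹ - 1)) := by
          rw [Real.exp_add]; ring
      _ = 1 := by
          rw [hcc, one_mul, show (c - 1) / 2 * (2 * (Real.log u * c⁻¹)) + Real.log u * (c⁻¹ - 1) =
            Real.log u * (c * c⁻¹ - 1) by ring, hcc, sub_self, mul_zero, Real.exp_zero]
  rw [setLIntegral_congr_fun measurableSet_Icc hspeed, setLIntegral_const, Real.volume_Icc, one_mul]

/-! ## The Lipschitz comparison function -/

include hval in
/-- **`Ψ(‖·‖²)` is `1`-Lipschitz for `d`** when `2|Ψ'(s)|√s ≤ e^{θ(s)}`: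
`|Ψ(‖x‖²) − Ψ(‖y‖²)| ≤ d(x, y)` (`ofReal_abs_sub_le_mul_riemEDist` with `|df(v)| ≤ |v|_{g_c}`). [folklore] -/
theorem ofReal_abs_sub_le_edist {Ψ : ℝ → ℝ} (hΨ : ContDiff ℝ ∞ Ψ)
    (hlip : ∀ s : ℝ, 2 * |deriv Ψ s| * Real.sqrt s ≤ Real.exp (θ s)) (x y : EuclideanFour) :
    ENNReal.ofReal |Ψ (‖x‖ ^ 2) - Ψ (‖y‖ ^ 2)| ≤ gc.edist hgc x y := by
  by_cases hfin : gc.edist hgc x y = ⊤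
  · rw [hfin]; exact le_top
  have hy : y ∈ gc.ball x ⊤ := by
    rw [PseudoRiemannianMetric.mem_ball, PseudoRiemannianMetric.riemEDist_eq hgc]
    exact lt_top_iff_ne_top.mpr hfin
  have hfs : ContDiff ℝ ∞ fun z : EuclideanFour ↦ Ψ (‖z‖ ^ 2) := hΨ.comp (contDiff_norm_sq ℝ)
  have hf : ContMDiffOn 𝓘(ℝ, EuclideanFour) 𝓘(ℝ, ℝ) 1 (fun z : EuclideanFour ↦ Ψ (‖z‖ ^ 2)) univ :=
    (hfs.contMDiff.of_le (by norm_cast)).contMDiffOn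
  have hL : ∀ z ∈ (univ : Set EuclideanFour), ∀ v : EuclideanFour,
      |mvfderiv 𝓘(ℝ, EuclideanFour) (fun z : EuclideanFour ↦ Ψ (‖z‖ ^ 2)) z v| ≤
        (1 : ℝ≥0) * Real.sqrt (gc.val z v v) := by
    intro z _ v
    rw [SmoothedConeModelMetric.mvfderiv_euclidean_apply, SmoothedConeModelMetric.fderiv_radial_apply hΨ,
      NNReal.coe_one, one_mul, sqrt_val hval, abs_mul, abs_mul, abs_two]
    have h1 : |⟪z, v⟫| ≤ ‖z‖ * ‖v‖ := abs_real_inner_le_norm z v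
    have h2 := hlip (‖z‖ ^ 2)
    rw [Real.sqrt_sq (norm_nonneg _)] at h2
    calc 2 * |deriv Ψ (‖z‖ ^ 2)| * |⟪z, v⟫| ≤ 2 * |deriv Ψ (‖z‖ ^ 2)| * (‖z‖ * ‖v‖) :=
        mul_le_mul_of_nonneg_left h1 (by positivity)
      _ = (2 * |deriv Ψ (‖z‖ ^ 2)| * ‖z‖) * ‖v‖ := by ring
      _ ≤ Real.exp (θ (‖z‖ ^ 2)) * ‖v‖ := mul_le_mul_of_nonneg_right h2 (norm_nonneg _)
  have h := ofReal_abs_sub_le_mul_riemEDist gc hgc isOpen_univ hf (L := 1) hL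
    (subset_univ (gc.ball x ⊤)) hy
  rwa [ENNReal.coe_one, one_mul, PseudoRiemannianMetric.riemEDist_eq hgc] at h

end SmoothedConeModelDistance

open SmoothedConeModelDistance in
/-- **Aux 3 of stub `helper_smoothedConeModel`: the distance of the smoothed cone is the cone
distance up to a constant.** For `0 < c`, smooth `θ, Ψ` with `θ(s) = log c + ((c−1)/2) log s`,
`Ψ(s) = s^{c/2}` for `s ≥ 1` and `2|Ψ'(s)|√s ≤ e^{θ(s)}`, and a Riemannian metric
`g_c = e^{2θ(‖x‖²)} δ` on `ℝ⁴`, there is `C` with `‖y‖^c − C ≤ d_{g_c}(0, y) ≤ ‖y‖^c + C` for all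
`y` (radial unit-speed path for the upper bound, the `1`-Lipschitz function `Ψ(‖·‖²)` for the lower
bound; O'Neill 1983, Ch. 5, Def. 15). [folklore] -/
theorem helper_smoothedConeModel_distance :
    ∀ c : ℝ, 0 < c → ∀ θ Ψ : ℝ → ℝ, ContDiff ℝ ∞ θ → ContDiff ℝ ∞ Ψ →
      (∀ s : ℝ, 1 ≤ s → θ s = Real.log c + (c - 1) / 2 * Real.log s) →
      (∀ s : ℝ, 1 ≤ s → Ψ s = s ^ (c / 2)) →
      (∀ s : ℝ, 2 * |deriv Ψ s| * Real.sqrt s ≤ Real.exp (θ s)) →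
      ∀ (gc : PseudoRiemannianMetric (𝓡 4) ∞ (EuclideanSpace ℝ (Fin 4))
          (TangentSpace (𝓡 4) : EuclideanSpace ℝ (Fin 4) → Type _)) (hgc : gc.IsRiemannian),
        (∀ (x : EuclideanSpace ℝ (Fin 4)) (v w : EuclideanSpace ℝ (Fin 4)),
          gc.val x v w = Real.exp (2 * θ (‖x‖ ^ 2)) * ⟪v, w⟫) →
        ∃ C : ℝ, (∀ y : EuclideanSpace ℝ (Fin 4), gc.edist hgc 0 y ≤ ENNReal.ofReal (‖y‖ ^ c + C)) ∧
          ∀ y : EuclideanSpace ℝ (Fin 4), ENNReal.ofReal (‖y‖ ^ c - C) ≤ gc.edist hgc 0 y := by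
  intro c hc θ Ψ hθ hΨ hcone hΨcone hlip gc hgc hval
  obtain ⟨C₀, hC₀0, hC₀⟩ := exists_edist_zero_le_of_norm_le_one hgc hval hθ.continuous
  refine ⟨max C₀ (|Ψ 0| + 1), fun y ↦ ?_, fun y ↦ ?_⟩
  · -- upper bound
    have hyc : 0 ≤ ‖y‖ ^ c := Real.rpow_nonneg (norm_nonneg _) _
    rcases le_or_gt ‖y‖ 1 with hy | hy
    · exact (hC₀ y hy).trans (ENNReal.ofReal_le_ofReal (by linarith [le_max_left C₀ (|Ψ 0| + 1)]))
    · have h1 := hC₀ (‖y‖⁻¹ • y) (by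
        rw [norm_smul, norm_inv, norm_norm, inv_mul_cancel₀ (by linarith)])
      have h2 := edist_unit_le hgc hval hc hcone hy.le
      calc gc.edist hgc 0 y ≤ gc.edist hgc 0 (‖y‖⁻¹ • y) + gc.edist hgc (‖y‖⁻¹ • y) y :=
            PseudoRiemannianMetric.edist_triangle hgc _ _ _
        _ ≤ ENNReal.ofReal C₀ + ENNReal.ofReal (‖y‖ ^ c - 1) := add_le_add h1 h2
        _ = ENNReal.ofReal (C₀ + (‖y‖ ^ c - 1)) :=
            (ENNReal.ofReal_add hC₀0 (by linarith [Real.one_le_rpow hy.le hc.le])).symm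
        _ ≤ ENNReal.ofReal (‖y‖ ^ c + max C₀ (|Ψ 0| + 1)) :=
            ENNReal.ofReal_le_ofReal (by linarith [le_max_left C₀ (|Ψ 0| + 1)])
  · -- lower bound
    rcases lt_or_ge ‖y‖ 1 with hy | hy
    · have h1 : ‖y‖ ^ c ≤ 1 := Real.rpow_le_one (norm_nonneg _) hy.le hc.le
      rw [ENNReal.ofReal_of_nonpos (by linarith [le_max_right C₀ (|Ψ 0| + 1), abs_nonneg (Ψ 0)])]
      exact bot_le
    · have h := ofReal_abs_sub_le_edist hgc hval hΨ hlip 0 y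
      have h0 : ‖(0 : EuclideanFour)‖ ^ 2 = 0 := by simp
      have hy2 : Ψ (‖y‖ ^ 2) = ‖y‖ ^ c := by
        rw [hΨcone (‖y‖ ^ 2) (by nlinarith), ← Real.rpow_natCast, ← Real.rpow_mul (norm_nonneg _)]
        congr 1
        push_cast
        ring
      rw [h0, hy2] at h
      refine le_trans (ENNReal.ofReal_le_ofReal ?_) h
      have : Ψ 0 ≤ |Ψ 0| := le_abs_self _
      have h3 : ‖y‖ ^ c - Ψ 0 ≤ |Ψ 0 - ‖y‖ ^ c| := by
        rw [abs_sub_comm]; exact le_abs_self _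
      linarith [le_max_right C₀ (|Ψ 0| + 1)]

end Summit.SmoothPoincare4.SmoothPoincare4.Theorems
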